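import Summits.BirchSwinnertonDyer.Rank1Residual.X2.ClassClosureO9RiemannSumCertificate
import Literature.NumberTheory.EllipticCurves.PlusSymbolBoundOddMultiplicativeProofs
import HarnessLib

/-!
# O9 (X2c), NON-SPLIT sub-cell: the Riemann-sum certificate WITHOUT the symbol-bound hypothesis —
# at an odd multiplicative prime in analytic rank one the plus symbols are `p`-integral, so ONE
# Riemann sum `p⁻ⁿ < ‖RS 1 n‖` is the whole per-pair input (cell `b2b-bsdres`, lane CLASS-CLOSURE,
# seat `cc-typer-6` GEN 10, O9 typer of record; theorems only — no definition, no named fact,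
# nothing booked)

HONEST FRAMING (run/shared/lean/b2b/bsd-rank1-residual/, verbatim in every file): the goal of the
cell is to DELETE the COMBINATION-SHAPED residual classes of the Birch–Swinnerton-Dyer formula for
ALL analytic-rank `≤ 1` elliptic curves over `ℚ` — "full BSD formula for every rank `≤ 1` curve in
class `C`" assembled STRICTLY from published theorems — so that the rank-`≤ 1` remainder becomes
exactly the CONSTRUCTION-SHAPED classes, which are TYPED (missing-input `Prop`s), NOT attempted.
This is not "finishing BSD". Lane CLASS-CLOSURE: research routes; no claim beyond the stated classes;
census / instrument output is EVIDENCE, never a Literature fact; per-pair certificates are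
INSTRUMENTATION (E4), never coverage. Every published theorem enters as one of the tree's named
Literature facts BY NAME; nothing about any particular curve is asserted; no label changes; X2c stays
CONSTRUCTION-SHAPED until referee A rules.

## What this file records

`X2/ClassClosureO9RiemannSumCertificate.lean` (p268579) reduced the per-pair Schneider input of the
non-split gvpar sub-cell `X2.CellCNonsplitGV` to the numerical pair `(hC, hlt)`: a UNIFORM bound
`∀ m a, ‖[a/pᵐ]⁺_{Dm.f}‖_p ≤ C` over ALL levels (which no finite symbol table supplies and which the
tree knew only to exist, Manin–Drinfeld) and ONE level `n` with `C·p⁻ⁿ < ‖RS 1 n‖`. The Literature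
theorem `IsNewformOf.norm_ratPlusSymbol_val_div_le_one_of_multiplicative_of_analyticRank_ne_zero`
(`PlusSymbolBoundOddMultiplicativeProofs`: cusp class of `1/p` at `p ∥ N` + the `U_p`-relation at
the cusp `0` + `[0]⁺_f = L(E,1)/Ω⁺_f = 0`) DISCHARGES `hC` with `C = 1` at every odd multiplicative
prime in positive analytic rank — no hypothesis on `E[p]` (reducible here), the `p`-adic image or the
Manin constant. Hence:

* `X2.schneider_of_nonsplit_riemannSum_lt_of_thm1` — ONE Riemann sum `p⁻ⁿ < ‖RS 1 n‖` of the signed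
  plus-symbol measure of `Dm.f` ⟹ Schneider for every §4.2 height datum at the pair;
* `X2.bsdp_of_cellC_of_not_split_of_gvPar_of_thm1_of_riemannSum_lt` — `X2.CellCNonsplitGV` ∧
  `p⁻ⁿ < ‖RS 1 n‖` ⟹ `BSD(E,p)` from the published named facts of p251198 (A183 `hD`; GV00 at
  `p ‖ N` `hGV`, flag `GV00-mult-asserted`; Wuthrich Thm. 16 `hWu`; SW Thm. 6.1 `hJn`, §4.2 existence
  `hHn`; GZK; modularity `hpar`);
* `X2.bsdp_of_cellC_of_not_split_of_mazurMainConjectureAt_of_thm1_of_riemannSum_lt` — the same on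
  X2c ∧ ¬split given Mazur's MC at the pair.

What an instrument row supplies is now EXACTLY one exact finite Riemann sum per pair (its valuation
`< n`), in the engine's normalisation (`x⁺_E = ±2ᵏ·ϖ·[·]⁺_f`, the lane's ONE stated-not-typed link
(α), `class-closure/O9/O9-window57-unitcoeff-instantiation.README-typer6.md` §3/§5). CONDITIONAL
theorems; nothing booked; no count moves; the split residue `X2.O9.ExceptionalLeadingTermAt` is
untouched.

References: [Disegni2020] Thm. 1 (§1.2); [MazurTateTeitelbaum1986Invent] §I.4 (4.2), §I.8, §I.10
Prop. (ε(p) = 0), §I.13; [CremonaAlgorithms1997] §2.2 Lemma 2.2.3; [SteinWuthrich2013] §3, §4.2,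
Thm. 6.1; [GreenbergVatsal2000] Thm. (1.3); [Wuthrich2014] Thm. 16.
-/

set_option autoImplicit false

noncomputable section

open scoped Classical MatrixGroups ModularForm

open CongruenceSubgroup WeierstrassCurve Literature.NumberTheory.EllipticCurves
  Literature.NumberTheory.EllipticCurves.ModularForms
  Literature.NumberTheory.EllipticCurves.Rank1Residual
  Literature.NumberTheory.EllipticCurves.Rank1Residual.Typed
  Literature.NumberTheory.EllipticCurves.GreenbergVatsal2000
  Literature.NumberTheory.EllipticCurves.Wuthrich2014
  Literature.NumberTheory.EllipticCurves.SteinWuthrich2013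
  Literature.NumberTheory.EllipticCurves.Disegni2020

namespace Summit.BirchSwinnertonDyer.Rank1Residual.X2

variable (W : WeierstrassCurve ℚ) [W.IsElliptic] [W.IsGloballyMinimal] (p : ℕ) [Fact p.Prime]

section RiemannSum

variable {N : ℕ} [NeZero N] (Dm : ModularParametrizationData W N) {RS : ℕ → ℕ → ℚ_[p]}
  (hRS : ∀ k n : ℕ, RS k n =
      ∑ᶠ ξ : rootsOfUnity (torsionOrder p) ℤ_[p], ∑ s : ZMod (p ^ n),
        (fun (n : ℕ) (a : ZMod (p ^ n)) ↦
            (-1 : ℚ_[p]) ^ n * (ratPlusSymbol Dm.f ((a.val : ℚ) / (p : ℚ) ^ n) : ℚ_[p]))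
          (n + cyclotomicExponent p)
            (PadicInt.toZModPow (n + cyclotomicExponent p) ((ξ : ℤ_[p]ˣ) : ℤ_[p]) *
              (cyclotomicGenerator p : ZMod (p ^ (n + cyclotomicExponent p))) ^ s.val) *
          ((s.val.choose k : ℕ) : ℚ_[p]))

include hRS

/-- **O9 non-split: ONE Riemann sum ⟹ Schneider, no symbol-bound hypothesis.** At a non-split
multiplicative `p ≠ 2` in analytic rank one, with a modular parametrisation datum `Dm`: the plus
symbols `[a/pᵐ]⁺_{Dm.f}` are `p`-integral at every level
(`IsNewformOf.norm_ratPlusSymbol_val_div_le_one_of_multiplicative_of_analyticRank_ne_zero`), so ONE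
level `n` with `p⁻ⁿ < ‖RS 1 n‖` gives `[T¹]L ≠ 0` for THE non-split function and hence Schneider for
every §4.2 datum (`schneider_of_nonsplit_riemannSum_certificate_of_thm1` with `C = 1`).
[cite: SteinWuthrich2013, §3 and §4.2] [cite: Disegni2020, Thm. 1 (§1.2)]
[cite: MazurTateTeitelbaum1986Invent, §I.4 (4.2), §I.8 and §I.10] -/
theorem schneider_of_nonsplit_riemannSum_lt_of_thm1
    (hD : thm1_padicBSD_rankOne_multiplicative) (hp2 : p ≠ 2)
    (hmult : W.HasMultiplicativeReductionAtPrime p) (hns : ¬ W.HasSplitMultiplicativeReductionAtPrime p)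
    (hr1 : W.analyticRank = 1) {n : ℕ} (hlt : (p : ℝ) ^ (-n : ℤ) < ‖RS 1 n‖)
    {q : ℚ_[p]} (hq0 : q ≠ 0) (hq1 : ‖q‖ < 1) (hqj : tateJ q = (W.j : ℚ_[p]))
    (Dh : PAdicHeightData W p) (hDh : IsMultCanonical Dh q) : SchneiderConjecture Dh :=
  schneider_of_nonsplit_riemannSum_certificate_of_thm1 W p Dm hRS hD hp2 hmult hns hr1 (C := 1)
    (fun m a ↦ Dm.isNewformOf.norm_ratPlusSymbol_val_div_le_one_of_multiplicative_of_analyticRank_ne_zero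
      hp2 hmult (by rw [hr1]; exact one_ne_zero) m a)
    (by rwa [one_mul]) hq0 hq1 hqj Dh hDh

/-- **Sub-cell `X2.CellCNonsplitGV` ∧ ONE Riemann sum ⟹ `BSD(E,p)`** — p268579's
`bsdp_of_cellC_of_not_split_of_gvPar_of_thm1_of_riemannSum_certificate` with its uniform symbol bound
`hC` DISCHARGED (`C = 1`, analytic rank one, odd multiplicative `p`). PUBLISHED named facts (A183 `hD`;
GV00 at `p ‖ N` `hGV`, flag `GV00-mult-asserted`; Wuthrich Thm. 16 `hWu`; SW Thm. 6.1 `hJn`, §4.2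
existence `hHn`; GZK; modularity `hpar`) + a modular parametrisation datum `Dm` + ONE inequality
`p⁻ⁿ < ‖RS 1 n‖` on an exact finite Riemann sum. CONDITIONAL; nothing booked; X2c stays
CONSTRUCTION-SHAPED. [cite: Disegni2020, Thm. 1 (§1.2)] [cite: GreenbergVatsal2000, Thm. (1.3) with pp. 1, 14–15]
[cite: Wuthrich2014, Thm. 16 (p. 397)] [cite: SteinWuthrich2013, Thm. 6.1 (p. 20), §3, §4.2] -/
theorem bsdp_of_cellC_of_not_split_of_gvPar_of_thm1_of_riemannSum_lt
    (hD : thm1_padicBSD_rankOne_multiplicative) (hGV : lambdaMu_multiplicative_of_gvPar)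
    (hWu : thm16_charIdeal_dvd_multiplicative_of_reducible) (hJn : thm61_nonsplitMultiplicative)
    (hHn : exists_isMultCanonical) (hGZK : rank_eq_analyticRank_of_analyticRank_le_one)
    (hpar : nonempty_modularParametrizationData) (hc : CellCNonsplitGV W p)
    {n : ℕ} (hlt : (p : ℝ) ^ (-n : ℤ) < ‖RS 1 n‖) : BSDp W p :=
  bsdp_of_cellC_of_not_split_of_gvPar_of_thm1_of_schneider W p hD hGV hWu hJn hHn hGZK hpar hc
    (fun _ Dh hq0 hq1 hqj hDh ↦ schneider_of_nonsplit_riemannSum_lt_of_thm1 W p Dm hRS hD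
      hc.1.2.1 hc.1.2.2.2 hc.2.1 hc.1.1 hlt hq0 hq1 hqj Dh hDh)

/-- **X2c ∧ ¬split ∧ Mazur's MC at the pair ∧ ONE Riemann sum ⟹ `BSD(E,p)`** — the whole non-split
half of O9 with `p⁻ⁿ < ‖RS 1 n‖` as the only numerical input (symbol bound discharged).
CONDITIONAL; nothing booked. [cite: Disegni2020, Thm. 1 (§1.2)]
[cite: SteinWuthrich2013, Thm. 6.1 (p. 20), §3, §4.2] -/
theorem bsdp_of_cellC_of_not_split_of_mazurMainConjectureAt_of_thm1_of_riemannSum_lt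
    (hD : thm1_padicBSD_rankOne_multiplicative) (hJn : thm61_nonsplitMultiplicative)
    (hHn : exists_isMultCanonical) (hGZK : rank_eq_analyticRank_of_analyticRank_le_one)
    (hpar : nonempty_modularParametrizationData)
    (hc : CellC W p) (hns : ¬ W.HasSplitMultiplicativeReductionAtPrime p)
    (hMC : MazurMainConjectureAt W p) {n : ℕ} (hlt : (p : ℝ) ^ (-n : ℤ) < ‖RS 1 n‖) : BSDp W p :=
  bsdp_of_cellC_of_not_split_of_mazurMainConjectureAt_of_thm1_of_schneider W p hD hJn hHn hGZK hpar
    hc hns hMC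
    (fun _ Dh hq0 hq1 hqj hDh ↦ schneider_of_nonsplit_riemannSum_lt_of_thm1 W p Dm hRS hD
      hc.2.1 hc.2.2.2 hns hc.1 hlt hq0 hq1 hqj Dh hDh)

end RiemannSum

end Summit.BirchSwinnertonDyer.Rank1Residual.X2

end
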